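import Summits.BirchSwinnertonDyer.BirchSwinnertonDyer.Theorems.ByReductionTypeAtTwoAdditiveRankZeroResidualV8
import Summits.BirchSwinnertonDyer.BirchSwinnertonDyer.Theorems.ByReductionTypeAtTwoAdditiveReducibleKatoMemberSharpNST
import HarnessLib

/-!
# Crux `AdditiveRankZeroAtTwo` (K4 item 19098): the crux BY NAME from its one-sided residual, v9 — child C2″
# `AdditivePotGoodReducibleRestAtTwo` (item 22616) is NO LONGER AN INPUT, and the over-`K` child C4″ (item 22618) is needed
# only on the `E[2]`-REDUCIBLE potentially multiplicative curves WITH a split multiplicative twist by `−1` or `−2` at `2`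
# (seat `bsd-2adic-k4-w2` GEN 4; sequel of addL2x GEN 15's v8; the new input is the SHARP member count, reading step R12♯)

Cell `bsd-2adic`, rung K4, crux stmt-BirchSwinnertonDyer-19098, split v2.2 (children C1″ 22615, C2″ 22616, C3″ 22617, C4″ 22618,
C5‴ 22619, glue 22620). `--supports` helper. HONEST FRAMING (D-0036/D-0054): an assembly-shaped CONDITIONAL theorem; every
research-grade input is displayed; closes nothing at the `∀`-level; nothing booked; BSD is not proved by any of this. NO restate
of the executed split is asked (record for the planner; D-0152).

WHAT v9 CHANGES (versus v8, p663936-lineage `additiveRankZeroAtTwo_of_residual_v8`). The member readings `hin`/`hinNST`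
(`Kato2004.exists_memberHullInputs_two{,_of_noSplitTwistNegOneNegTwo}`, count exponent `3t`) are replaced by the ONE sharp
reading `hinS = Kato2004.exists_memberHullInputs_two_sharp_of_noSplitTwistNegOneNegTwo` (count exponent `2t`; R12♯ of
`Kato2004/MemberHullInputsTwoSharp.lean`: the factor `#H¹_F(ℚ,T)` and Cassels' cokernel `#(S₂(E/ℚ)/H¹_F(ℚ,T))` of the audited
count are complementary; it implies `hin`, `hinNST` and the potentially-good sharp fact — `…_of_noSplitTwistSharp` lemmas of
`…AdditiveReducibleKatoMemberSharpNST.lean`). Consequences: (1) the binder `hRest` = child C2″ DISAPPEARS — on the potentially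
good reducible curves the upper half is `additivePotGoodReducibleUpperAtTwo_of_sharpMember` (no side condition); (2) the member
branch on the potentially multiplicative reducible (NST′) curves loses its conjunct «no point of order `4`·(odd) in the class ∧
`ord₂ #Ш_an` even» (`addPotMultNST_reducibleUpper_two_sharp`), so `hLowMred` is now keyed WITHOUT that conjunct (`hLowMred9`:
the lower half over `ℚ` on {potentially multiplicative, (NST′), reducible} — a larger lower-half habitat, the upper half being
free there) and the over-`K` binder shrinks to `hQKm9` := C4″ on {potentially multiplicative, `E[2]` reducible, NOT (NST′)} =
the reducible curves with a split multiplicative twist by `−1` or `−2`; (3) the Cassels–Tate pairing `hCT` is still an input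
only through the potentially-good door's signature (`addPotGood_bsdp_two_of_kato_of_lower`), not through any parity argument.

Inputs of `additiveRankZeroAtTwo_of_residual_v9`: PRINT {`hGZK`, `hmod`, `hmodN`, `hMilneC`, `hHL`, `hLim2`, `hFW`, `hCassels`,
`hCT`} + READINGS {`hNST2` (D-audit PASS), `hinS` (hMHnst@2 + R12♯; D-audit wanted)} + TARGET {`hX`} + sibling {`hMult`} +
research `∀`-objects {C1″ `hAna`, C3″ `hLow` (VERBATIM children), (I1M′) `hAnaMI`, (I3M′) `hLowMI`, (I3M_red′) `hLowMred9`,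
(I4⁽⁹⁾) `hQKm9`}. So on the whole ADDITIVE block the residual reads: {(A) on `S₃`-image (C1″ ∪ I1M′), lower half over `ℚ`
(C3″ ∪ I3M′ ∪ I3M_red′), target `hX` (irreducible split-twist), C4″ | reducible split-twist} modulo {2 readings, PRINT}.
`hQKm9_of_additivePotMultOverKAtTwo`: C4″ ⟹ `hQKm9` (verbatim weakening). `hRest` needs no supplier any more; for the record
`additivePotGoodReducibleRestAtTwo_of_sharpMember` (p673737) derives it from the same names.

References: [Kato2004Asterisque] Thm. 12.5 (3)(4), (12.5.1) (p. 222), Conj. 12.10 (p. 224), 13.13, Thm. 12.6, §14.8, §14.14,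
Prop. 14.16 (2) and its proof (pp. 238–245); [MazurRubin2004] Thm. 2.3.4; [SilvermanATAEC1994] V.5.3, Ex. 5.11;
[CoatesSujatha2005] statement (A); [Lim2017FineSelmer] Thm. 3.5; [Milne1972ArithmeticAV] Thm. 1; [HoffsteinLuo1997];
[Cassels1965ArithmeticVIII]; [SilvermanAEC2009] X.4.14; [Miller2011LMS] Def. 1.1. Memo
`run/shared/lean/pub/bsd-2adic/k4w2/gen4/READING-hMH2sharp-count-2t.md`.
-/

set_option autoImplicit false
set_option linter.dupNamespace false

noncomputable section

open scoped Classical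

namespace Summit.BirchSwinnertonDyer.BirchSwinnertonDyer.Theorems.AddKatoTwo

open WeierstrassCurve Literature.NumberTheory.EllipticCurves
  Literature.NumberTheory.EllipticCurves.ModularForms
  Literature.NumberTheory.EllipticCurves.Kato2004
  Literature.NumberTheory.EllipticCurves.Rank1Residual
  Literature.NumberTheory.EllipticCurves.Rank1Residual.Typed
  Literature.NumberTheory.IwasawaTheory
  Summit.BirchSwinnertonDyer.Rank1Residual Summit.BirchSwinnertonDyer.Rank1Residual.AdditivePotMult
  Summit.BirchSwinnertonDyer.Rank1Residual.X5.AddTwoL2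
  Summit.BirchSwinnertonDyer.BirchSwinnertonDyer.Theses.ByReductionTypeAtTwo
  Summit.BirchSwinnertonDyer.BirchSwinnertonDyer.Theorems.SemistableKatoTwo

/-! ## §1 The crux BY NAME, ONE-SIDED (glue v9) -/

/-- **The crux `AdditiveRankZeroAtTwo` (item stmt-BirchSwinnertonDyer-19098; type = the route decl verbatim) from its
ONE-SIDED residual, v9.** Inputs: PRINT {`hGZK`, `hmod`, `hmodN`, `hMilneC`, `hHL`, `hLim2`, `hFW`, `hCassels`, `hCT`} +
READINGS {`hNST2`, `hinS` = the (NST′) member package WITH THE SHARP COUNT} + TARGET {`hX` = `KatoSharpAtTwoAdditiveSplitTwist`}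
+ the sibling crux `hMult` (`MultiplicativeRankZeroAtTwo`, item 19096) + research `∀`-objects: C1″ `hAna`, C3″ `hLow` (VERBATIM
children), (I1M′) `hAnaMI`, (I3M′) `hLowMI`, (I3M_red′) `hLowMred9` = the lower half over `ℚ` on the reducible (NST′) potentially
multiplicative curves (NO torsion/parity conjunct), (I4⁽⁹⁾) `hQKm9` = child C4″ RESTRICTED to {potentially multiplicative, `E[2]`
reducible, NOT (NST′)}. NO binder for child C2″. Branches: `0 ≤ ord₂ j` → the potentially-good door
`addPotGood_bsdp_two_of_kato_of_lower` with its `hin`/`hRest` arguments SUPPLIED (`exists_memberHullInputs_two_of_sharp`,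
`additivePotGoodReducibleUpperAtTwo_of_sharpMember`); else irreducible → v8's §1; else (NST′) → upper by
`addPotMultNST_reducibleUpper_two_sharp` + lower `hLowMred9`; else over `K` at the curve (`addPotMult_bsdp_two_of_mult_of_overKC_at`).
Conditional (audit `proof.conditional`); the item is NOT closed.
[cite: Kato2004Asterisque, Thm. 12.5 (3) and (12.5.1) (p. 222), Conj. 12.10 (p. 224), 13.13 (p. 233), Thm. 12.6 (p. 222), §14.8 (p. 238), §14.14 (p. 243), Prop. 14.16 (2) and its proof (pp. 244–245)]
[cite: MazurRubin2004, Thm. 2.3.4] [cite: SilvermanATAEC1994, Thm. V.5.3 and Exercise 5.11] [cite: CoatesSujatha2005, statement (A)]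
[cite: Lim2017FineSelmer, §3 Thm. 3.5] [cite: Milne1972ArithmeticAV, Thm. 1] [cite: HoffsteinLuo1997, Theorem]
[cite: Cassels1965ArithmeticVIII] [cite: SilvermanAEC2009, Thm. X.4.14] [cite: Miller2011LMS, Def. 1.1] -/
theorem additiveRankZeroAtTwo_of_residual_v9
    (hGZK : rank_eq_analyticRank_of_analyticRank_le_one) (hmod : hasEntireLFunction_rat) (hmodN : exists_isNewformOf)
    (hMilneC : Milne1972.bsdQuotient_baseChange_quadratic_anyModel)
    (hHL : HoffsteinLuo1997_exists_twist_L_one_ne_zero)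
    (hLim2 : Lim2017.thm35_at_two_fineSelmerDual_moduleFinite_of_classicalMuVanishes_of_le_divisionField_four)
    (hFW : ferreroWashington1979_classicalMuVanishes)
    (hCassels : bsdRHS_eq_of_isIsogenous) (hCT : exists_casselsTate_pairing (K := ℚ))
    (hNST2 : Kato2004.rankZero_padicValNat_sha_add_padicValNat_tamagawa_le_at_two_of_noSplitTwistNegOneNegTwo_of_irreducible_of_fineSelmerDual_fg)
    (hX : KatoSharpAtTwoAdditiveSplitTwist)
    (hinS : Kato2004.exists_memberHullInputs_two_sharp_of_noSplitTwistNegOneNegTwo)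
    (hMult : MultiplicativeRankZeroAtTwo)
    (hAna : ∀ (W : WeierstrassCurve ℚ) [W.IsElliptic] [W.IsGloballyMinimal], ¬ W.HasCM → W.analyticRank = 0 →
      Addv W 2 → 0 ≤ padicValRat 2 W.j → ¬ IsAbelianGalois ℚ (W.divisionField 2) →
      ∀ (κ : ZpExtension ℚ 2), κ.IsCyclotomic →
        ∃ (γ : Field.absoluteGaloisGroup ℚ) (D : W.FineSelmerDualData κ γ),
          Module.Finite ℤ_[2] (RestrictScalars ℤ_[2] (IwasawaAlgebra 2) D.X))
    (hLow : ∀ (W : WeierstrassCurve ℚ) [W.IsElliptic] [W.IsGloballyMinimal], ¬ W.HasCM → W.analyticRank = 0 →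
      Addv W 2 → 0 ≤ padicValRat 2 W.j → MissingLowerBoundAt W 2)
    (hAnaMI : ∀ (W : WeierstrassCurve ℚ) [W.IsElliptic] [W.IsGloballyMinimal], ¬ W.HasCM → W.analyticRank = 0 →
      Addv W 2 → padicValRat 2 W.j < 0 → W.HasIrreducibleModPGaloisRep 2 → ¬ IsAbelianGalois ℚ (W.divisionField 2) →
      ∀ (κ : ZpExtension ℚ 2), κ.IsCyclotomic →
        ∃ (γ : Field.absoluteGaloisGroup ℚ) (D : W.FineSelmerDualData κ γ),
          Module.Finite ℤ_[2] (RestrictScalars ℤ_[2] (IwasawaAlgebra 2) D.X))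
    (hLowMI : ∀ (W : WeierstrassCurve ℚ) [W.IsElliptic] [W.IsGloballyMinimal], ¬ W.HasCM → W.analyticRank = 0 →
      Addv W 2 → padicValRat 2 W.j < 0 → W.HasIrreducibleModPGaloisRep 2 → MissingLowerBoundAt W 2)
    (hLowMred9 : ∀ (W : WeierstrassCurve ℚ) [W.IsElliptic] [W.IsGloballyMinimal], ¬ W.HasCM → W.analyticRank = 0 →
      Addv W 2 → padicValRat 2 W.j < 0 →
      (∀ d : ℚ, d = -1 ∨ d = -2 → ¬ (W.quadraticTwist d).HasSplitMultiplicativeReductionAtPrime 2) →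
      ¬ W.HasIrreducibleModPGaloisRep 2 → MissingLowerBoundAt W 2)
    (hQKm9 : ∀ (W : WeierstrassCurve ℚ) [W.IsElliptic] [W.IsGloballyMinimal], ¬ W.HasCM → W.analyticRank = 0 →
      Addv W 2 → padicValRat 2 W.j < 0 → ¬ W.HasIrreducibleModPGaloisRep 2 →
      ¬ (∀ d : ℚ, d = -1 ∨ d = -2 → ¬ (W.quadraticTwist d).HasSplitMultiplicativeReductionAtPrime 2) →
      ∀ (K : Type) [Field K] [NumberField K], Module.finrank ℚ K = 2 →
        SemistableTwistAtTwo W K → (W.quadraticTwist (NumberField.discr K : ℚ)).entireLFunction 1 ≠ 0 →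
          MissingPPartOverCAt (W.baseChange K) 2) :
    Summit.BirchSwinnertonDyer.BirchSwinnertonDyer.Theses.ByReductionTypeAtTwo.AdditiveRankZeroAtTwo := by
  unfold Summit.BirchSwinnertonDyer.BirchSwinnertonDyer.Theses.ByReductionTypeAtTwo.AdditiveRankZeroAtTwo
  intro W _ _ hcm hr hadd
  haveI : Fact (Nat.Prime 2) := ⟨Nat.prime_two⟩
  -- the potentially-good sharp member fact and the audited one, both implied by `hinS`
  have hinPG : Kato2004.exists_memberHullInputs_two_sharp := exists_memberHullInputs_two_sharp_of_noSplitTwistSharp hinS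
  have hin : Kato2004.exists_memberHullInputs_two := exists_memberHullInputs_two_of_sharp hinPG
  by_cases hj : 0 ≤ padicValRat 2 W.j
  · -- potentially good: v4's door with `hRest` SUPPLIED by the sharp member theorem (no side condition)
    exact addPotGood_bsdp_two_of_kato_of_lower hGZK hmod hmodN hLim2 hFW hCassels hCT
      (katoAtTwoSharp_of_katoAtTwoNST' hNST2) hin hAna
      (fun W _ _ hcm hr hadd hj hirr _ =>
        additivePotGoodReducibleUpperAtTwo_of_sharpMember hmodN hmod hinPG hLim2 hFW hCassels hGZK W hcm hr hadd hj hirr)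
      hLow W hcm hr hadd hj
  · have hj' : padicValRat 2 W.j < 0 := lt_of_not_ge hj
    by_cases hirr : W.HasIrreducibleModPGaloisRep 2
    · -- potentially multiplicative, irreducible: v8's uniform door
      exact addPotMultIrr_bsdp_two_of_target_of_conjA_of_lower hNST2 hX hGZK hmod hLim2 hFW hAnaMI hLowMI W hcm hr
        hadd hj' hirr
    · by_cases hnst : ∀ d : ℚ, d = -1 ∨ d = -2 → ¬ (W.quadraticTwist d).HasSplitMultiplicativeReductionAtPrime 2
      · -- reducible, (NST′): SHARP member upper half (no side condition) + the displayed lower half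
        have hr1 : W.analyticRank ≤ 1 := by rw [hr]; exact zero_le_one
        exact bsdp_of_missingPPartAt W 2 hGZK hr1
          (missingPPartAt_of_lower_of_upper W 2 (hLowMred9 W hcm hr hadd hj' hnst hirr)
            (addPotMultNST_reducibleUpper_two_sharp hmodN hmod hinS hLim2 hFW hCassels hGZK W hcm hr hadd hj' hnst hirr))
      · -- reducible with a split multiplicative twist by `−1` or `−2`: over `K` at the curve (child C4″, restricted)
        exact addPotMult_bsdp_two_of_mult_of_overKC_at hGZK hmod hMilneC hHL hMult W hcm hr hadd hj'
          (hQKm9 W hcm hr hadd hj' hirr hnst)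

/-! ## §2 The executed children supply the v9 binders -/

/-- **C4″ ⟹ its restriction (I4⁽⁹⁾)**: the executed child `AdditivePotMultOverKAtTwo` (item 22618) implies the v9 binder `hQKm9`
(a verbatim weakening: the extra hypotheses `¬ irreducible`, `¬ (NST′)` are dropped). Recorded so the planner sees that v9
consumes nothing beyond the filed split on the over-`K` side. [cite: Milne1972ArithmeticAV, Thm. 1] -/
theorem hQKm9_of_additivePotMultOverKAtTwo (h : AdditivePotMultOverKAtTwo) :
    ∀ (W : WeierstrassCurve ℚ) [W.IsElliptic] [W.IsGloballyMinimal], ¬ W.HasCM → W.analyticRank = 0 →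
      Addv W 2 → padicValRat 2 W.j < 0 → ¬ W.HasIrreducibleModPGaloisRep 2 →
      ¬ (∀ d : ℚ, d = -1 ∨ d = -2 → ¬ (W.quadraticTwist d).HasSplitMultiplicativeReductionAtPrime 2) →
      ∀ (K : Type) [Field K] [NumberField K], Module.finrank ℚ K = 2 →
        SemistableTwistAtTwo W K → (W.quadraticTwist (NumberField.discr K : ℚ)).entireLFunction 1 ≠ 0 →
          MissingPPartOverCAt (W.baseChange K) 2 := by
  intro W _ _ hcm hr hadd hj _ _ K _ _ h2 hst hL
  exact h W hcm hr hadd hj K h2 hst hL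

/-- **v9's research binders are implied by v8's plus nothing**: the only NEW-looking binder `hLowMred9` (lower half on the
reducible (NST′) potentially multiplicative curves, no conjunct) is implied by the crux itself (`BSDp ⟹ MissingLowerBoundAt`,
`missingPPartAt_of_bsdp`, `Ш` finite by GZK) — i.e. it is a genuine PART of the crux, not an import. Bookkeeping.
[cite: Miller2011LMS, §1 and Def. 1.1] -/
theorem hLowMred9_of_additiveRankZeroAtTwo (hGZK : rank_eq_analyticRank_of_analyticRank_le_one)
    (h : Summit.BirchSwinnertonDyer.BirchSwinnertonDyer.Theses.ByReductionTypeAtTwo.AdditiveRankZeroAtTwo) :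
    ∀ (W : WeierstrassCurve ℚ) [W.IsElliptic] [W.IsGloballyMinimal], ¬ W.HasCM → W.analyticRank = 0 →
      Addv W 2 → padicValRat 2 W.j < 0 →
      (∀ d : ℚ, d = -1 ∨ d = -2 → ¬ (W.quadraticTwist d).HasSplitMultiplicativeReductionAtPrime 2) →
      ¬ W.HasIrreducibleModPGaloisRep 2 → MissingLowerBoundAt W 2 := by
  intro W _ _ hcm hr hadd _ _ _
  haveI : Fact (Nat.Prime 2) := ⟨Nat.prime_two⟩
  have hr1 : W.analyticRank ≤ 1 := by rw [hr]; exact zero_le_one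
  haveI : Finite W.sha := (hGZK W hr1).2
  exact (lower_and_upper_of_missingPPartAt W 2 (missingPPartAt_of_bsdp W 2 (h W hcm hr hadd))).1

end Summit.BirchSwinnertonDyer.BirchSwinnertonDyer.Theorems.AddKatoTwo

end
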